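import Mathlib.AlgebraicGeometry.Noetherian
import Mathlib.RingTheory.Ideal.MinimalPrime.Noetherian
import HarnessLib

/-!
# Maximal points of a closed subset: local finiteness, closedness of multiplicity strata

Topic: `Literature/AlgebraicGeometry/Resolution`. Point-set topology of the irreducible
components of a closed subset `Z` of a locally Noetherian scheme, phrased through their generic
points — the points of `Z` that are maximal in `Z` for the specialisation order (`maxPoints Z`).
Used for the closedness of the strata "at least `j` branches through the point" of a strict
normal crossings divisor (node F5 of the decomposition of `DeJong1996NormalCrossingsBlowup`,
de Jong 1996, 2.4; `NormalCrossingsStrictification.lean`). Everything is PROVED.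

* `maxPoints Z` — the maximal points of `Z ⊆ X` (generic points of the irreducible components of
  `Z`, for `Z` closed in a sober space).
* `finite_maxPoints_inter_of_isAffineOpen` — **local finiteness**: an affine open of a locally
  Noetherian scheme contains only finitely many maximal points of a closed `Z` (they inject into
  the minimal primes of the ideal `I_Z(U)`).
* `isClosed_setOf_le_encard_specializes` — **the stratum of points lying under at least `j`
  members of a set `M` of maximal points of `Z` is closed**: near `t`, after removing the
  closures of the finitely many nearby members of `M` that do not specialise to `t`, every
  member of `M` specialising to a point specialises to `t`.

## Superseded copies

The same set was introduced, with byte-identical body, as the scheme-setup abbrev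
`DeJong1996.Descent45.Setup.maxPts` (`AlterationsDescentLimit2.lean`, with `finite_maxPts` for a
closed subset of a Noetherian sober `T₀` space) and is the hypothesis shape of
`Set.Finite.of_forall_specializes_eq` (`AlterationsSemiStableCodimTwo.lean`). The present
general definition `maxPoints` (any topological space) is meant as their common survivor (a
librarian may turn `maxPts` into `abbrev maxPts := maxPoints` and derive
`of_forall_specializes_eq` from it). On a scheme, `maxPoints Z = {η | Maximal (· ∈ Z) η}` for
Mathlib's specialisation preorder on points (`Scheme.le_iff_specializes : a ≤ b ↔ b ⤳ a`),
`maxPoints_eq_setOf_maximal`.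

## Sources

* The Stacks Project, Tag 0BA8 (= Lemma 28.5.7: a Noetherian scheme has finitely many
  irreducible components — applied to the Noetherian schemes `U` for affine opens `U` of a
  locally Noetherian scheme), Tag 01J7 (points of `Spec 𝒪_{X,x}` = generisations of `x`).
  [StacksProject]
-/

noncomputable section

open CategoryTheory AlgebraicGeometry TopologicalSpace Topology

universe u

namespace Literature.AlgebraicGeometry.Resolution

/-- The **maximal points** of a subset `Z` of a topological space: the points of `Z` admitting
no proper generisation inside `Z` (for `Z` closed in a sober space: the generic points of the
irreducible components of `Z`). [folklore] -/
def maxPoints {α : Type*} [TopologicalSpace α] (Z : Set α) : Set α :=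
  {η | η ∈ Z ∧ ∀ η' ∈ Z, η' ⤳ η → η' = η}

/-- Unfolding lemma for `maxPoints`. [folklore] -/
theorem mem_maxPoints_iff {α : Type*} [TopologicalSpace α] {Z : Set α} {η : α} :
    η ∈ maxPoints Z ↔ η ∈ Z ∧ ∀ η' ∈ Z, η' ⤳ η → η' = η :=
  Iff.rfl

/-- Maximal points of `Z` lie in `Z`. [folklore] -/
theorem maxPoints_subset {α : Type*} [TopologicalSpace α] (Z : Set α) : maxPoints Z ⊆ Z :=
  fun _ h => h.1

variable {X : Scheme.{u}}

/-- On a scheme, the maximal points of `Z` are the maximal elements of `Z` for Mathlib's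
specialisation preorder on points (`a ≤ b ↔ b ⤳ a`). [folklore] -/
theorem maxPoints_eq_setOf_maximal (Z : Set X) : maxPoints Z = {η | Maximal (· ∈ Z) η} := by
  ext η
  simp only [mem_maxPoints_iff, Set.mem_setOf_eq, Maximal]
  refine and_congr_right fun _ => ⟨fun h η' hη' hle => ?_, fun h η' hη' hs => ?_⟩
  · have hs : η' ⤳ η := Scheme.le_iff_specializes.mp hle
    exact le_of_eq (h η' hη' hs)
  · have hle : η ≤ η' := Scheme.le_iff_specializes.mpr hs
    have hs' : η ⤳ η' := Scheme.le_iff_specializes.mp (h hη' hle)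
    exact (hs.antisymm hs').eq

/-! ## Local finiteness -/

/-- For an affine open `U` and a closed `Z`, the prime of `Γ(X, U)` of a maximal point of `Z`
lying in `U` is a minimal prime of the ideal `I_Z(U)` of sections vanishing on `Z ∩ U` (a
smaller prime is the prime of a generisation inside `Z`). [folklore] -/
theorem primeIdealOf_mem_minimalPrimes_of_mem_maxPoints {U : X.Opens} (hU : IsAffineOpen U)
    {Z : Set X} (hZ : IsClosed Z) {η : X} (hη : η ∈ maxPoints Z) (hηU : η ∈ U) :
    (hU.primeIdealOf ⟨η, hηU⟩).asIdeal ∈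
      (PrimeSpectrum.vanishingIdeal (hU.fromSpec ⁻¹' Z)).minimalPrimes := by
  have hcl : IsClosed (hU.fromSpec ⁻¹' Z) := hZ.preimage hU.fromSpec.continuous
  refine ⟨⟨inferInstance, ?_⟩, fun q ⟨hq, hqle⟩ hqη => ?_⟩
  · -- sections vanishing on `Z` vanish at `η ∈ Z`
    intro f hf
    rw [PrimeSpectrum.mem_vanishingIdeal] at hf
    exact hf _ (by rw [Set.mem_preimage, IsAffineOpen.fromSpec_primeIdealOf]; exact hη.1)
  · -- a smaller prime containing `I_Z(U)` is the prime of a generisation of `η` inside `Z`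
    haveI := hq
    let q' : PrimeSpectrum Γ(X, U) := ⟨q, hq⟩
    have hq'Z : hU.fromSpec q' ∈ Z := by
      have h1 : q' ∈ PrimeSpectrum.zeroLocus (PrimeSpectrum.vanishingIdeal (hU.fromSpec ⁻¹' Z)) :=
        hqle
      rw [PrimeSpectrum.zeroLocus_vanishingIdeal_eq_closure] at h1
      have h2 : q' ∈ hU.fromSpec ⁻¹' Z := hcl.closure_subset h1
      exact h2
    have hspec : hU.fromSpec q' ⤳ η := by
      have h1 : q' ⤳ hU.primeIdealOf ⟨η, hηU⟩ := (PrimeSpectrum.le_iff_specializes _ _).mp hqη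
      have h2 := h1.map hU.fromSpec.continuous
      rwa [IsAffineOpen.fromSpec_primeIdealOf] at h2
    have heq : hU.fromSpec q' = η := hη.2 _ hq'Z hspec
    have : q' = hU.primeIdealOf ⟨η, hηU⟩ := by
      apply hU.fromSpec.isOpenEmbedding.injective
      rw [heq, IsAffineOpen.fromSpec_primeIdealOf]
    exact le_of_eq (congrArg PrimeSpectrum.asIdeal this).symm

/-- **Maximal points are locally finite**: an affine open `U` of a locally Noetherian scheme
contains only finitely many maximal points of a closed subset `Z` — they inject into the
(finitely many) minimal primes of `I_Z(U) ⊆ Γ(X, U)` (Stacks 0BA8, finiteness of the irreducible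
components of a Noetherian scheme, applied to `Z ∩ U`; here through the Noetherian ring `Γ(X, U)`).
[cite: StacksProject, Tag 0BA8] -/
theorem finite_maxPoints_inter_of_isAffineOpen [IsLocallyNoetherian X] {U : X.Opens}
    (hU : IsAffineOpen U) {Z : Set X} (hZ : IsClosed Z) : (maxPoints Z ∩ (U : Set X)).Finite := by
  haveI : IsNoetherianRing Γ(X, U) := IsLocallyNoetherian.component_noetherian ⟨U, hU⟩
  set J : Ideal Γ(X, U) := PrimeSpectrum.vanishingIdeal (hU.fromSpec ⁻¹' Z) with hJ
  have hfin : J.minimalPrimes.Finite := J.finite_minimalPrimes_of_isNoetherianRing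
  -- the injection into the minimal primes
  let g : ↥(maxPoints Z ∩ (U : Set X)) → ↥J.minimalPrimes := fun η =>
    ⟨(hU.primeIdealOf ⟨η.1, η.2.2⟩).asIdeal,
      primeIdealOf_mem_minimalPrimes_of_mem_maxPoints hU hZ η.2.1 η.2.2⟩
  have hg : Function.Injective g := by
    intro η₁ η₂ h
    have h' : hU.primeIdealOf ⟨η₁.1, η₁.2.2⟩ = hU.primeIdealOf ⟨η₂.1, η₂.2.2⟩ :=
      PrimeSpectrum.ext (congrArg Subtype.val h)
    apply Subtype.ext
    have := congrArg hU.fromSpec h'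
    rwa [IsAffineOpen.fromSpec_primeIdealOf, IsAffineOpen.fromSpec_primeIdealOf] at this
  haveI : Finite ↥J.minimalPrimes := hfin
  exact Set.finite_coe_iff.mp (Finite.of_injective g hg)

/-- Every point has an open neighbourhood containing only finitely many maximal points of a
given closed subset (of a locally Noetherian scheme; Stacks 0BA8 applied to an affine open
neighbourhood). [cite: StacksProject, Tag 0BA8] -/
theorem exists_isOpen_finite_maxPoints_inter [IsLocallyNoetherian X] {Z : Set X}
    (hZ : IsClosed Z) (t : X) :
    ∃ U : Set X, IsOpen U ∧ t ∈ U ∧ (maxPoints Z ∩ U).Finite := by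
  obtain ⟨U, hU, htU, -⟩ :=
    exists_isAffineOpen_mem_and_subset (X := X) (x := t) (U := ⊤) (Opens.mem_top _)
  exact ⟨U, U.isOpen, htU, finite_maxPoints_inter_of_isAffineOpen hU hZ⟩

/-! ## Closedness of the strata -/

/-- **The stratum of points under at least `j` members of a set of maximal points is closed.**
Let `Z` be a closed subset of a locally Noetherian scheme, `M` a set of maximal points of `Z`,
and `j : ℕ`. Then `{t | j ≤ #{η ∈ M | η ⤳ t}}` is closed. Indeed, for `t` outside, choose an
open `U ∋ t` meeting only finitely many members of `M` and remove the closures of those not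
specialising to `t`; on the resulting neighbourhood `V` of `t`, every member of `M` specialising
to a point of `V` lies in `U` (as `V` is open) and specialises to `t`, so the count does not
exceed the count at `t`. [folklore] -/
theorem isClosed_setOf_le_encard_specializes [IsLocallyNoetherian X] {Z : Set X} (hZ : IsClosed Z)
    {M : Set X} (hM : M ⊆ maxPoints Z) (j : ℕ) :
    IsClosed {t : X | (j : ℕ∞) ≤ {η ∈ M | η ⤳ t}.encard} := by
  rw [← isOpen_compl_iff, isOpen_iff_forall_mem_open]
  intro t ht
  simp only [Set.mem_compl_iff, Set.mem_setOf_eq, not_le] at ht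
  obtain ⟨U, hUo, htU, hfin⟩ := exists_isOpen_finite_maxPoints_inter hZ t
  -- the finitely many nearby members of `M` not specialising to `t`
  set B : Set X := {η ∈ M ∩ U | ¬ η ⤳ t} with hB
  have hBfin : B.Finite := (hfin.subset (Set.inter_subset_inter_left _ hM)).subset (fun η hη => hη.1)
  let V : Set X := U \ ⋃ η ∈ B, closure {η}
  have hVo : IsOpen V := hUo.sdiff (hBfin.isClosed_biUnion fun η _ => isClosed_closure)
  have htV : t ∈ V := by
    refine ⟨htU, fun h => ?_⟩
    simp only [Set.mem_iUnion] at h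
    obtain ⟨η, hηB, hηt⟩ := h
    exact hηB.2 (specializes_iff_mem_closure.mpr hηt)
  refine ⟨V, fun t' ht' => ?_, hVo, htV⟩
  -- at `t' ∈ V` the count is at most the count at `t`
  simp only [Set.mem_compl_iff, Set.mem_setOf_eq, not_le]
  refine lt_of_le_of_lt (Set.encard_le_encard fun η hη => ?_) ht
  obtain ⟨hηM, hηt'⟩ := hη
  refine ⟨hηM, ?_⟩
  have hηU : η ∈ U := hηt'.mem_open hUo ht'.1
  by_contra hηt
  have hηB : η ∈ B := ⟨⟨hηM, hηU⟩, hηt⟩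
  apply ht'.2
  simp only [Set.mem_iUnion]
  exact ⟨η, hηB, specializes_iff_mem_closure.mp hηt'⟩

end Literature.AlgebraicGeometry.Resolution

end
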